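import Literature.NumberTheory.GaloisRepresentations.ArtinRestriction
import Mathlib.GroupTheory.IndexNormal
import Mathlib.Data.ZMod.QuotientGroup
import HarnessLib

/-!
# Dihedral-type representations are monomial (Clifford): the index-two subgroup
(trunk GalRep; companion to `ProjectiveType`, `ProjectiveTypeSolvable`, `ArtinRestriction`)

Let `k` be an algebraically closed field of characteristic `0` and `ρ : G → GL_2(k)` a
homomorphism with finite image of **dihedral type**: its projective image
`\bar ρ(G) ≤ PGL_2(k)` is isomorphic to a dihedral group `D_m`, `m ≥ 2` (`Literature.NumberTheory.GaloisRepresentations.IsDihedralType`).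
This file proves the classical structure theorem behind "dihedral type = monomial = induced from a
character of a quadratic subextension" (Gelbart, *Three lectures on the modularity of
`ρ̄_{E,3}` and the Langlands reciprocity conjecture* (1997), §4.3, Proposition: "(ii) Dihedral
type: `σ` is irreducible of the form `Ind_{W_E}^{W_F} θ`, with `θ` a character …, `E` a quadratic
extension of `F`, and `θ ≠ θ^τ` … (Such representations are also called monomial.)"; in the
Langlands–Tunnell context: Tunnell, Bull. AMS 5 (1981), p. 173, "Artin proved the conjecture
for monomial representations … the nonmonomial two-dimensional representations are those with
image in `PGL(2, ℂ)` isomorphic to … the tetrahedron, octahedron or icosahedron"):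

* `Literature.NumberTheory.GaloisRepresentations.exists_monomial_of_isDihedralType` (**proved**): there are a subgroup `H ≤ G` of index
  `2` (the inverse image of the cyclic subgroup `C_m ◁ D_m` of rotations) and `P ∈ GL_2(k)` such
  that `P ρ(h) P⁻¹` is diagonal for `h ∈ H` and antidiagonal for `g ∉ H`; moreover some
  `h₀ ∈ H` has distinct diagonal entries.  In other words, in the basis given by `P` the
  representation is monomial, `ρ|_H = χ₁ ⊕ χ₂`, and `G ∖ H` swaps the two eigenlines, so that
  `ρ ≅ Ind_H^G χ₁` (made explicit for Artin representations in
  `Literature.NumberTheory.GaloisRepresentations.ArtinDihedralInduced`).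

Proof (elementary, `2 × 2` matrices): a lift `h₀` of the rotation `r` has finite order and is
non-scalar, so is diagonalisable with distinct eigenvalues (`GL2.exists_conj_eq_diagonal`);
every `h ∈ H` maps to a power of `\bar r`, hence commutes with `ρ(h₀)` and is diagonal
(`GL2.isDg_of_commute_diagonal`); for `g ∉ H`, `ρ(g)` normalises the diagonal group `ρ(H)`
(`H ◁ G`), so is diagonal or antidiagonal (`GL2.isDg_or_isAd_of_mul_diagonal`), and "diagonal"
would make all of `ρ(G)` diagonal, giving a common eigenvector and a *cyclic* projective image
(`isCyclicType_of_hasCommonEigenvector`), contradicting `D_m` non-cyclic for `m ≥ 2`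
(Mathlib `DihedralGroup.not_isCyclic`).

## Mathlib / tree search

Mathlib (this pin): `DihedralGroup` (`r`, `sr`, `orderOf_r_one`, `nat_card`, `not_isCyclic`),
`Subgroup.index_comap_of_surjective`, `Subgroup.mul_mem_iff_of_index_two`,
`Subgroup.normal_of_index_eq_two`, `Matrix.ProjGenLinGroup.mk_eq_mk_iff`; no Clifford theory
for projective types (grep `monomial`, `Dihedral` in `RepresentationTheory`: nothing).  Tree:
`Literature.NumberTheory.GaloisRepresentations.projectiveImage`, `IsDihedralType` (`ProjectiveType`), `GL2.IsDg/IsAd`,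
`GL2.exists_conj_eq_diagonal`, `conjGL`, `HasCommonEigenvector`,
`hasCommonEigenvector_of_forall_isDg`, `projectiveImage_range_subtype`
(`ProjectiveTypeSolvable`), `isCyclicType_of_hasCommonEigenvector` (`ArtinRestriction`).
No definition is introduced; nothing is duplicated (`lean search monomial_of_isDihedral`,
`index_two`: nothing relevant).

## References

* S. Gelbart, *Three lectures on the modularity of `ρ̄_{E,3}` and the Langlands reciprocity
  conjecture*, in *Modular Forms and Fermat's Last Theorem* (Cornell–Silverman–Stevens, eds.),
  Springer 1997, §4.3, Proposition (types of two-dimensional representations; (ii) dihedral =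
  monomial = induced from a quadratic extension). [Gelbart1997]
* J. Tunnell, *Artin's conjecture for representations of octahedral type*, Bull. AMS 5 (1981),
  p. 173. [Tunnell1981]
* J.-P. Serre, *Linear Representations of Finite Groups*, GTM 42 (1977), §3.3 (induced
  representations: `V = ⊕ σW`). [SerreLinearRepresentations1977]
-/

noncomputable section

open Matrix Subgroup
open scoped MatrixGroups

namespace Literature.NumberTheory.GaloisRepresentations

variable {G : Type*} [Group G] {k : Type*} [Field k]

local notation "M₂" => Matrix (Fin 2) (Fin 2) k

/-- A common eigenvector for `ρ` is a common eigenvector for the inclusion of its image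
(reduction to a finite group). [folklore] -/
theorem HasCommonEigenvector.range_subtype {ρ : G →* GL (Fin 2) k} (h : HasCommonEigenvector ρ) :
    HasCommonEigenvector ρ.range.subtype := by
  obtain ⟨v, hv, key⟩ := h
  refine ⟨v, hv, ?_⟩
  rintro ⟨_, g, rfl⟩
  exact key g

/-- A representation of dihedral type is not of cyclic type (`D_m`, `m ≥ 2`, is not cyclic;
Mathlib `DihedralGroup.not_isCyclic`). [folklore] -/
theorem IsDihedralType.not_isCyclicType {n : Type*} [Fintype n] [DecidableEq n] {R : Type*}
    [CommRing R] {ρ : G →* GL n R} (h : IsDihedralType ρ) : ¬ IsCyclicType ρ := by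
  obtain ⟨m, hm, ⟨e⟩⟩ := h
  intro hc
  haveI : IsCyclic (projectiveImage ρ) := hc
  exact DihedralGroup.not_isCyclic (n := m) (by omega) (isCyclic_of_surjective e e.surjective)

/-- If all `ρ(g)` are diagonal in some basis then `ρ` is of cyclic type (common eigenvector;
`isCyclicType_of_hasCommonEigenvector` applied to the finite group `ρ(G)`). [folklore] -/
theorem isCyclicType_of_forall_isDg_conjGL [CharZero k] (ρ : G →* GL (Fin 2) k) [Finite ρ.range]
    (P : GL (Fin 2) k) (h : ∀ g, GL2.IsDg ((conjGL P ρ g : GL (Fin 2) k) : M₂)) :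
    IsCyclicType ρ := by
  have hev : HasCommonEigenvector ρ :=
    HasCommonEigenvector.of_conjGL (hasCommonEigenvector_of_forall_isDg h)
  have hc : IsCyclicType ρ.range.subtype :=
    isCyclicType_of_hasCommonEigenvector ρ.range.subtype hev.range_subtype
  unfold IsCyclicType at hc ⊢
  rwa [projectiveImage_range_subtype] at hc

variable [IsAlgClosed k] [CharZero k]

/-- **Dihedral type ⇒ monomial (Clifford's theorem for `D_m`).**  Let `k` be algebraically
closed of characteristic `0` and `ρ : G → GL_2(k)` have finite image and dihedral projective
image `\bar ρ(G) ≅ D_m`, `m ≥ 2`.  Then there are a subgroup `H ≤ G` of index `2` and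
`P ∈ GL_2(k)` such that `P ρ(h) P⁻¹` is diagonal for all `h ∈ H`, `P ρ(g) P⁻¹` is antidiagonal
for all `g ∉ H`, and some `h₀ ∈ H` has `P ρ(h₀) P⁻¹ = diag(d₀, d₁)` with `d₀ ≠ d₁`.
(`H` is the inverse image of the rotation subgroup `C_m ◁ D_m`; so `ρ|_H ≅ χ₁ ⊕ χ₂` with
`χ₁ ≠ χ₂` and `ρ ≅ Ind_H^G χ₁`: the group-theoretic content of Gelbart 1997, §4.3,
Proposition (ii), "dihedral type: `σ` is irreducible of the form `Ind θ` … `E` a quadratic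
extension … also called monomial"; Tunnell 1981, p. 173, "monomial".)
[cite: Gelbart1997, §4.3, Proposition (ii)] [cite: Tunnell1981, p. 173] -/
theorem exists_monomial_of_isDihedralType (ρ : G →* GL (Fin 2) k) [Finite ρ.range]
    (hρ : IsDihedralType ρ) :
    ∃ (H : Subgroup G) (P : GL (Fin 2) k), H.index = 2 ∧
      (∀ g, g ∈ H → GL2.IsDg ((conjGL P ρ g : GL (Fin 2) k) : M₂)) ∧
      (∀ g, g ∉ H → GL2.IsAd ((conjGL P ρ g : GL (Fin 2) k) : M₂)) ∧
      ∃ h₀, h₀ ∈ H ∧ ((conjGL P ρ h₀ : GL (Fin 2) k) : M₂) 0 0 ≠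
        ((conjGL P ρ h₀ : GL (Fin 2) k) : M₂) 1 1 := by
  classical
  have hnc : ¬ IsCyclicType ρ := hρ.not_isCyclicType
  obtain ⟨m, hm, ⟨e⟩⟩ := hρ
  haveI : Fact (1 < m) := ⟨hm⟩
  -- `θ : G → D_m`, the composite `G → \bar ρ(G) ≅ D_m`
  set π : G →* PGL(Fin 2, k) := Matrix.ProjGenLinGroup.mk.comp ρ with hπ
  let πr : G →* projectiveImage ρ := π.rangeRestrict
  have hπr : ∀ g, ((πr g : projectiveImage ρ) : PGL(Fin 2, k)) = Matrix.ProjGenLinGroup.mk (ρ g) :=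
    fun g => rfl
  let θ : G →* DihedralGroup m := e.toMonoidHom.comp πr
  have hθ : ∀ g, θ g = e (πr g) := fun g => rfl
  have hθsurj : Function.Surjective θ :=
    e.surjective.comp (MonoidHom.rangeRestrict_surjective π)
  -- the rotation subgroup and its inverse image `H`
  set R : Subgroup (DihedralGroup m) := zpowers (DihedralGroup.r 1) with hR
  have hRcard : Nat.card R = m := by rw [hR, Nat.card_zpowers, DihedralGroup.orderOf_r_one]
  have hRindex : R.index = 2 := by
    have h1 := R.card_mul_index
    rw [hRcard, DihedralGroup.nat_card, mul_comm 2 m] at h1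
    exact Nat.eq_of_mul_eq_mul_left (by omega) h1
  set H : Subgroup G := R.comap θ with hH
  have hHindex : H.index = 2 := by rw [hH, index_comap_of_surjective R hθsurj, hRindex]
  haveI hHn : H.Normal := normal_of_index_eq_two hHindex
  have hmemH : ∀ g, g ∈ H ↔ θ g ∈ R := fun g => Iff.rfl
  -- a lift `h₀` of the rotation `r 1`
  obtain ⟨h₀, hh₀⟩ := hθsurj (DihedralGroup.r 1)
  have hh₀H : h₀ ∈ H := by rw [hmemH, hh₀]; exact mem_zpowers _
  have hh₀nc : ρ h₀ ∉ center (GL (Fin 2) k) := by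
    intro hc
    have h1 : πr h₀ = 1 := by
      apply Subtype.ext
      rw [hπr, OneMemClass.coe_one, Matrix.ProjGenLinGroup.mk_eq_one]
      exact hc
    have h2 : (DihedralGroup.r 1 : DihedralGroup m) = DihedralGroup.r 0 := by
      rw [← hh₀, hθ, h1, map_one, DihedralGroup.one_def]
    exact one_ne_zero (DihedralGroup.r.inj h2)
  have hh₀fin : IsOfFinOrder (ρ h₀) := by
    have := ρ.range.subtype.isOfFinOrder (isOfFinOrder_of_finite (⟨ρ h₀, h₀, rfl⟩ : ρ.range))
    exact this
  obtain ⟨N, hN, hN1⟩ := hh₀fin.exists_pow_eq_one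
  obtain ⟨Q, d, hd, hQ⟩ := GL2.exists_conj_eq_diagonal (ρ h₀) hN hN1 hh₀nc
  -- conjugate by `P = Q⁻¹`
  set P : GL (Fin 2) k := Q⁻¹ with hP
  set ρ' : G →* GL (Fin 2) k := conjGL P ρ with hρ'
  have hρ'h₀ : ((ρ' h₀ : GL (Fin 2) k) : M₂) = diagonal d := by
    rw [hρ', conjGL_apply, hP, inv_inv, hQ]
  -- elements of `H` commute with `h₀` modulo nothing: `θ g ∈ ⟨r⟩` forces `\bar ρ(g) = \bar ρ(h₀)^i`
  have hcomm : ∀ g, g ∈ H → Commute (ρ g) (ρ h₀) := by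
    intro g hg
    rw [hmemH] at hg
    obtain ⟨i, hi⟩ := mem_zpowers_iff.mp hg
    have h1 : πr g = πr h₀ ^ i := by
      apply e.injective
      rw [map_zpow, ← hθ, ← hθ, hh₀, hi]
    have h2 : Matrix.ProjGenLinGroup.mk (ρ g) = Matrix.ProjGenLinGroup.mk (ρ h₀ ^ i) := by
      rw [← hπr, h1, map_zpow]; rfl
    obtain ⟨u, hu⟩ := Matrix.ProjGenLinGroup.mk_eq_mk_iff.mp h2
    -- `ρ g * scalar u = ρ h₀ ^ i`
    have hsc : Matrix.GeneralLinearGroup.scalar (Fin 2) u ∈ center (GL (Fin 2) k) := by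
      rw [Matrix.GeneralLinearGroup.center_eq_range_scalar]; exact ⟨u, rfl⟩
    have h3 : ρ g = ρ h₀ ^ i * (Matrix.GeneralLinearGroup.scalar (Fin 2) u)⁻¹ := by
      rw [← hu, mul_inv_cancel_right]
    rw [h3]
    exact ((Commute.refl (ρ h₀)).zpow_left i).mul_left
      ((mem_center_iff.mp (inv_mem hsc)) (ρ h₀)).symm
  have hDg : ∀ g, g ∈ H → GL2.IsDg ((ρ' g : GL (Fin 2) k) : M₂) := by
    intro g hg
    refine GL2.isDg_of_commute_diagonal hd ?_
    rw [← hρ'h₀, ← Matrix.GeneralLinearGroup.coe_mul, ← Matrix.GeneralLinearGroup.coe_mul]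
    congr 1
    exact ((hcomm g hg).map (MulAut.conj P).toMonoidHom).eq
  -- elements outside `H` are diagonal or antidiagonal …
  have hDgAd : ∀ g, GL2.IsDg ((ρ' g : GL (Fin 2) k) : M₂) ∨ GL2.IsAd ((ρ' g : GL (Fin 2) k) : M₂) := by
    intro g
    have hconj : g * h₀ * g⁻¹ ∈ H := hHn.conj_mem h₀ hh₀H g
    have hy := (hDg _ hconj).eq_diagonal
    refine GL2.isDg_or_isAd_of_mul_diagonal (GL2.det_ne_zero (ρ' g)) hd
      (d' := ![((ρ' (g * h₀ * g⁻¹) : GL (Fin 2) k) : M₂) 0 0,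
        ((ρ' (g * h₀ * g⁻¹) : GL (Fin 2) k) : M₂) 1 1]) ?_
    rw [← hy, ← hρ'h₀, ← Matrix.GeneralLinearGroup.coe_mul, ← Matrix.GeneralLinearGroup.coe_mul]
    congr 1
    rw [map_mul, map_mul, map_inv, inv_mul_cancel_right]
  -- … and not diagonal, lest `ρ` be of cyclic type
  have hAd : ∀ g, g ∉ H → GL2.IsAd ((ρ' g : GL (Fin 2) k) : M₂) := by
    intro g hg
    rcases hDgAd g with hdg | had
    · exfalso
      apply hnc
      refine isCyclicType_of_forall_isDg_conjGL ρ P fun g' => ?_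
      by_cases hg' : g' ∈ H
      · exact hDg g' hg'
      · have hmem : g⁻¹ * g' ∈ H := by
          rw [mul_mem_iff_of_index_two hHindex]
          exact iff_of_false (fun h => hg (inv_mem_iff.mp h)) hg'
        have : g' = g * (g⁻¹ * g') := by group
        rw [this, map_mul, Matrix.GeneralLinearGroup.coe_mul]
        exact hdg.mul (hDg _ hmem)
    · exact had
  refine ⟨H, P, hHindex, hDg, hAd, h₀, hh₀H, ?_⟩
  rw [hρ'h₀, diagonal_apply_eq, diagonal_apply_eq]
  exact hd

end Literature.NumberTheory.GaloisRepresentations
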